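import Mathlib
import Literature.Analysis.UnboundedOperators.DiagonalOperator

/-!
# Skew-cut certificate: the standard resolvent symbol and weights for a non-positive diagonal part
(instab4 g4 — implementation 2 of the skew-cut X0 certifier, cell `ns-blowup`, 2026-08-26)

HONEST FRAMING (human ruling D-0035): nothing here is a claim about Navier–Stokes blow-up.
WHAT THIS IS NOT: not NS evidence. MODEL lane bookkeeping. The end-to-end statements
`SkewCutGalerkinMaster.exists_smooth_eigenvector_Ioo` / `SkewCutGalerkinFromSections.…_of_sections`
take the free part through a symbol `d ∈ ℓ^∞` with `d_i (x₀ − ℓ_i) = 1`, `d_i → 0`, and weights `w` with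
`0 ≤ w_i`, `w_i² ≤ 1 + |ℓ_i|`, `‖d_i‖ w_i ≤ M`. For the model (`L₀ = νΔ`, levels `ℓ_i = −ν|k_i|² ≤ 0`,
`ℓ_i → −∞` along the cofinite filter — finitely many modes below any level) and any base point
`x₀ ≥ 1`, `exists_resolventSymbol` produces these data with the STANDARD choices
`d_i = (x₀ − ℓ_i)⁻¹`, `w_i = (1 + |ℓ_i|)^{1/2}`, `M = 1`, so those hypotheses are discharged once and for
all; what the consumer still supplies is `ℓ ≤ 0` and `ℓ → −∞` for its enumeration of the class basis.

Mathlib + `Literature.Analysis.UnboundedOperators.DiagonalOperator` (for the `lp` conventions); no new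
definitions.
-/

noncomputable section

namespace Summit.NavierStokesRegularity.FluidComputer.SkewCutGalerkinWeights

open Filter Topology

variable {ι 𝕜 : Type*} [RCLike 𝕜]

/-- **Standard resolvent symbol and weights.** For levels `ℓ_i ≤ 0` with `ℓ_i → −∞` (cofinite) and a
base point `x₀ ≥ 1` there is `d ∈ ℓ^∞(ι, 𝕜)` with `d_i = (x₀ − ℓ_i)⁻¹`, `d_i (x₀ − ℓ_i) = 1`,
`‖d_i‖ → 0`, and, for the weights `w_i = √(1 + |ℓ_i|)`: `0 ≤ w_i`, `w_i² ≤ 1 + |ℓ_i|`, `‖d_i‖ w_i ≤ 1`. -/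
theorem exists_resolventSymbol (ℓ : ι → ℝ) (hℓ : ∀ i, ℓ i ≤ 0) (hℓt : Tendsto ℓ cofinite atBot)
    (x₀ : ℝ) (hx₀ : 1 ≤ x₀) :
    ∃ d : lp (fun _ : ι => 𝕜) ⊤,
      (∀ i, d i = (((x₀ - ℓ i)⁻¹ : ℝ) : 𝕜)) ∧
      (∀ i, d i * ((x₀ : 𝕜) - (ℓ i : 𝕜)) = 1) ∧
      Tendsto (fun i => ‖d i‖) cofinite (𝓝 0) ∧
      (∀ i, 0 ≤ Real.sqrt (1 + |ℓ i|)) ∧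
      (∀ i, Real.sqrt (1 + |ℓ i|) ^ 2 ≤ 1 + |ℓ i|) ∧
      (∀ i, ‖d i‖ * Real.sqrt (1 + |ℓ i|) ≤ 1) := by
  have hpos : ∀ i, 1 ≤ x₀ - ℓ i := fun i => by linarith [hℓ i]
  have hpos' : ∀ i, 0 < x₀ - ℓ i := fun i => lt_of_lt_of_le one_pos (hpos i)
  -- the symbol as a function, bounded by `1`
  set f : ι → 𝕜 := fun i => (((x₀ - ℓ i)⁻¹ : ℝ) : 𝕜) with hf
  have hfn : ∀ i, ‖f i‖ = (x₀ - ℓ i)⁻¹ := fun i => by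
    rw [hf, RCLike.norm_ofReal, abs_of_pos (inv_pos.2 (hpos' i))]
  have hfle : ∀ i, ‖f i‖ ≤ 1 := fun i => by
    rw [hfn]; exact inv_le_one_of_one_le₀ (hpos i)
  have hmem : Memℓp f ⊤ := memℓp_infty ⟨1, by rintro _ ⟨i, rfl⟩; exact hfle i⟩
  refine ⟨⟨f, hmem⟩, fun i => rfl, fun i => ?_, ?_, fun i => Real.sqrt_nonneg _, fun i => ?_,
    fun i => ?_⟩
  · -- `d_i (x₀ - ℓ_i) = 1`
    change f i * ((x₀ : 𝕜) - (ℓ i : 𝕜)) = 1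
    rw [hf, ← RCLike.ofReal_sub, ← RCLike.ofReal_mul, inv_mul_cancel₀ (hpos' i).ne', RCLike.ofReal_one]
  · -- `‖d_i‖ → 0`
    change Tendsto (fun i => ‖f i‖) cofinite (𝓝 0)
    simp_rw [hfn]
    have h1 : Tendsto (fun i => x₀ - ℓ i) cofinite atTop := by
      have h := tendsto_atTop_add_const_left _ x₀ (tendsto_neg_atTop_iff.2 hℓt)
      simpa [sub_eq_add_neg] using h
    exact tendsto_inv_atTop_zero.comp h1
  · exact (Real.sq_sqrt (by positivity)).le
  · -- `‖d_i‖ √(1 + |ℓ_i|) ≤ 1`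
    change ‖f i‖ * Real.sqrt (1 + |ℓ i|) ≤ 1
    rw [hfn]
    have h1 : 1 + |ℓ i| ≤ x₀ - ℓ i := by rw [abs_of_nonpos (hℓ i)]; linarith
    have h2 : Real.sqrt (1 + |ℓ i|) ≤ x₀ - ℓ i := by
      calc Real.sqrt (1 + |ℓ i|) ≤ Real.sqrt (x₀ - ℓ i) := Real.sqrt_le_sqrt h1
        _ ≤ x₀ - ℓ i := by
            rw [Real.sqrt_le_left (hpos' i).le]
            nlinarith [hpos i]
    calc (x₀ - ℓ i)⁻¹ * Real.sqrt (1 + |ℓ i|) ≤ (x₀ - ℓ i)⁻¹ * (x₀ - ℓ i) :=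
          mul_le_mul_of_nonneg_left h2 (inv_nonneg.2 (hpos' i).le)
      _ = 1 := inv_mul_cancel₀ (hpos' i).ne'

end Summit.NavierStokesRegularity.FluidComputer.SkewCutGalerkinWeights

end
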